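import Summits.QuantumFields.YangMills.Theorems.AllWindowsColdBoxBoxHighLineTiltSupBounds
import Summits.QuantumFields.YangMills.Theorems.AllWindowsColdBoxBoxHighLineErrorBudget

/-!
# T-S5.13s (part 4, β-letters) — `sup_D |tiltU| ≤ ε for β ≥ β₀` in the ASSEMBLY-S5 parameters `s = β^{−1/2+κ₃}`, `H ≤ β^θ + 1`
# (planner ym-idea-2 g18, `Cruxes/BoxHighWindowsSU22/ASSEMBLY-S5.md` §1/§5/§8 «sup_D|U| ≤ 1 (six monomials)»; LINE-19 S5 ⟨stmt-QuantumFields-24004⟩/⟨24335⟩)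

Width seat `ym-line-sfw-p2-w4` (prover-ym-line-sfw-p2-w4-g28-0).  The package ✓`TiltSup.abs_tiltU_le_of (h7d)` (`|tiltU| ≤ C(1+log H)^m(|β|H⁴s³ + H⁶s²)` on
`smallField H s`, `s ≤ 1`, `sH² ≤ c₀`) instantiated at the assembly's small-field radius `s = β^{−1/2+κ₃}` with w2's ✓`ErrorBudget.exists_forall_natPow_log_le`:

* `TiltSup.rpow_neg_half_add_le_one` (`β^{−1/2+κ₃} ≤ 1` for `β ≥ 1`, `κ₃ ≤ 1/2`), `beta_mul_rpow_cube` / `rpow_sq_eq` (the two monomials as `H^k/β^γ`: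
  `β·H⁴·s³ = H⁴/β^{1/2−3κ₃}`, `H⁶·s² = H⁶/β^{1−2κ₃}`), `rpow_mul_sq_eq` (`s·H² = H²/β^{1/2−κ₃}`);
* **`TiltSup.exists_forall_abs_tiltU_le (h7d : GhostTaylor)`** — for `0 < θ`, `12θ < 1`, `κ₃ < (1/2 − 4θ)/3` and any `ε > 0` there is `β₀ ≥ 1` such that for all
  `β ≥ β₀` and all `H` with `1 ≤ H ≤ β^θ + 1`: every `a ∈ smallField H (β^{−1/2+κ₃})` has `|tiltU β H a| ≤ ε` (so `e^{tU} ∈ [e^{−ε}, e^{ε}]` on `D`, §5/§6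
  NORM TRANSFER with `ε = 1`); the premises `s ≤ 1`, `s·H² ≤ c₀` of the package are discharged inside (`2θ < 1/2 − κ₃`).

Only 7d (`GhostTaylor`, w3 g40) is a hypothesis.  Everything proved; no definitions; standard axioms.  HONEST LABEL: helper lemmas for the OPEN assembly T-S5.13 of the
XL stub S5 of a critic-PASSed DRAFT line; S5, U5, ⟨24004⟩ ⟨24335⟩ ⟨24336⟩ remain OPEN; no crux, rung or summit is proved; the Yang–Mills mass gap is NOT proved by this file.
-/

set_option autoImplicit false

open Real

namespace Summit.QuantumFields.YangMills.Theorems.AllWindowsColdBoxBoxHighLine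

namespace TiltSup

/-! ## `rpow` bookkeeping for `s = β^{−1/2+κ₃}` -/

/-- `β^{−1/2+κ} ≤ 1` for `β ≥ 1`, `κ ≤ 1/2`. -/
theorem rpow_neg_half_add_le_one {β κ : ℝ} (hβ : 1 ≤ β) (hκ : κ ≤ 1 / 2) : β ^ (-1 / 2 + κ) ≤ 1 :=
  Real.rpow_le_one_of_one_le_of_nonpos hβ (by linarith)

/-- `β · (β^{−1/2+κ})³ = 1/β^{1/2−3κ}` (`β > 0`). -/
theorem beta_mul_rpow_cube {β κ : ℝ} (hβ : 0 < β) : β * (β ^ (-1 / 2 + κ)) ^ 3 = 1 / β ^ (1 / 2 - 3 * κ) := by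
  rw [← Real.rpow_natCast (β ^ (-1 / 2 + κ)) 3, ← Real.rpow_mul hβ.le, one_div, ← Real.rpow_neg hβ.le]
  conv_lhs => rw [show β * β ^ ((-1 / 2 + κ) * ((3 : ℕ) : ℝ)) = β ^ (1 : ℝ) * β ^ ((-1 / 2 + κ) * ((3 : ℕ) : ℝ)) by rw [Real.rpow_one]]
  rw [← Real.rpow_add hβ]
  congr 1
  push_cast
  ring

/-- `(β^{−1/2+κ})² = 1/β^{1−2κ}` (`β > 0`). -/
theorem rpow_sq_eq {β κ : ℝ} (hβ : 0 < β) : (β ^ (-1 / 2 + κ)) ^ 2 = 1 / β ^ (1 - 2 * κ) := by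
  rw [← Real.rpow_natCast (β ^ (-1 / 2 + κ)) 2, ← Real.rpow_mul hβ.le, one_div, ← Real.rpow_neg hβ.le]
  congr 1
  push_cast
  ring

/-- `β^{−1/2+κ} = 1/β^{1/2−κ}` (`β > 0`). -/
theorem rpow_eq_one_div {β κ : ℝ} (hβ : 0 < β) : β ^ (-1 / 2 + κ) = 1 / β ^ (1 / 2 - κ) := by
  rw [one_div, ← Real.rpow_neg hβ.le]
  congr 1
  ring

/-! ## The sup bound in the assembly's parameters -/

/-- **`sup_D |tiltU| ≤ ε` for `β ≥ β₀`, GIVEN T-S5.7d.**  For `0 < θ`, `12θ < 1`, `κ₃ < (1/2 − 4θ)/3` and `ε > 0` there is `β₀ ≥ 1` such that for all `β ≥ β₀`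
and all `H : ℕ` with `1 ≤ H`, `H ≤ β^θ + 1`, every `a ∈ smallField H (β^{−1/2+κ₃})` satisfies `|tiltU β H a| ≤ ε`
(✓`TiltSup.abs_tiltU_le_of`: the monomials `C(1+log H)^m·H⁴/β^{1/2−3κ₃}` and `C(1+log H)^m·H⁶/β^{1−2κ₃}` and the premise `H²/β^{1/2−κ₃} ≤ c₀` are each
eventually small by ✓`ErrorBudget.exists_forall_natPow_log_le`, since `4θ < 1/2 − 3κ₃`, `6θ < 1 − 2κ₃`, `2θ < 1/2 − κ₃`). -/
theorem exists_forall_abs_tiltU_le (h7d : GhostTaylor) {θ κ₃ ε : ℝ} (hθ : 0 < θ) (h12 : 12 * θ < 1) (hκu : κ₃ < (1 / 2 - 4 * θ) / 3)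
    (hε : 0 < ε) :
    ∃ β₀ : ℝ, 1 ≤ β₀ ∧ ∀ β : ℝ, β₀ ≤ β → ∀ H : ℕ, 1 ≤ H → (H : ℝ) ≤ β ^ θ + 1 →
      ∀ a ∈ smallField H (β ^ (-1 / 2 + κ₃)), |tiltU β H a| ≤ ε := by
  obtain ⟨C, c₀, m, hc₀, hU⟩ := abs_tiltU_le_of h7d
  have hθ0 : 0 ≤ θ := hθ.le
  have hε2 : 0 < ε / 2 := by linarith
  -- the three thresholds
  obtain ⟨b₁, hb₁1, hb₁⟩ := ErrorBudget.exists_forall_natPow_log_le (k := 4) (γ := 1 / 2 - 3 * κ₃) hθ0 (by push_cast; linarith) hε2 C m 0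
  obtain ⟨b₂, hb₂1, hb₂⟩ := ErrorBudget.exists_forall_natPow_log_le (k := 6) (γ := 1 - 2 * κ₃) hθ0 (by push_cast; linarith) hε2 C m 0
  obtain ⟨b₃, hb₃1, hb₃⟩ := ErrorBudget.exists_forall_natPow_log_le (k := 2) (γ := 1 / 2 - κ₃) hθ0 (by push_cast; linarith) hc₀ 1 0 0
  refine ⟨max b₁ (max b₂ b₃), le_max_of_le_left hb₁1, fun β hβ H hH hHβ a ha => ?_⟩
  have hβ1 : b₁ ≤ β := (le_max_left _ _).trans hβ
  have hβ2 : b₂ ≤ β := ((le_max_left _ _).trans (le_max_right _ _)).trans hβ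
  have hβ3 : b₃ ≤ β := ((le_max_right _ _).trans (le_max_right _ _)).trans hβ
  have hβone : 1 ≤ β := hb₁1.trans hβ1
  have hβpos : 0 < β := by linarith
  set s : ℝ := β ^ (-1 / 2 + κ₃) with hs
  have hs0 : 0 ≤ s := Real.rpow_nonneg hβpos.le _
  have hs1 : s ≤ 1 := rpow_neg_half_add_le_one hβone (by linarith)
  -- premise `s·H² ≤ c₀`
  have h3 := hb₃ β hβ3 H hH hHβ
  have hsH : s * (H : ℝ) ^ 2 ≤ c₀ := by
    have e : s * (H : ℝ) ^ 2 = 1 * (H : ℝ) ^ 2 * (1 + Real.log H) ^ 0 * (1 + Real.log β) ^ 0 / β ^ (1 / 2 - κ₃) := by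
      rw [hs, rpow_eq_one_div hβpos, pow_zero, pow_zero]; ring
    rw [e]; exact h3
  have hmain := hU H hH β s hs0 hs1 hsH a ha
  -- the two monomials
  have h1 := hb₁ β hβ1 H hH hHβ
  have h2 := hb₂ β hβ2 H hH hHβ
  have e1 : C * (1 + Real.log H) ^ m * (|β| * (H : ℝ) ^ 4 * s ^ 3) =
      C * (H : ℝ) ^ 4 * (1 + Real.log H) ^ m * (1 + Real.log β) ^ 0 / β ^ (1 / 2 - 3 * κ₃) := by
    rw [abs_of_pos hβpos, pow_zero, hs]
    have := beta_mul_rpow_cube (κ := κ₃) hβpos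
    calc C * (1 + Real.log H) ^ m * (β * (H : ℝ) ^ 4 * (β ^ (-1 / 2 + κ₃)) ^ 3)
        = C * (1 + Real.log H) ^ m * (H : ℝ) ^ 4 * (β * (β ^ (-1 / 2 + κ₃)) ^ 3) := by ring
      _ = C * (1 + Real.log H) ^ m * (H : ℝ) ^ 4 * (1 / β ^ (1 / 2 - 3 * κ₃)) := by rw [this]
      _ = _ := by ring
  have e2 : C * (1 + Real.log H) ^ m * ((H : ℝ) ^ 6 * s ^ 2) =
      C * (H : ℝ) ^ 6 * (1 + Real.log H) ^ m * (1 + Real.log β) ^ 0 / β ^ (1 - 2 * κ₃) := by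
    rw [pow_zero, hs, rpow_sq_eq hβpos]; ring
  have hsplit : C * (1 + Real.log H) ^ m * (|β| * (H : ℝ) ^ 4 * s ^ 3 + (H : ℝ) ^ 6 * s ^ 2) =
      C * (1 + Real.log H) ^ m * (|β| * (H : ℝ) ^ 4 * s ^ 3) + C * (1 + Real.log H) ^ m * ((H : ℝ) ^ 6 * s ^ 2) := by ring
  rw [hsplit, e1, e2] at hmain
  linarith

end TiltSup

end Summit.QuantumFields.YangMills.Theorems.AllWindowsColdBoxBoxHighLine
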